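import Summits.ABC.ABC.Theorems.IsogenyGlueCongruenceModularJacobianMultipliers
import Summits.ABC.ABC.Theorems.DefiniteXiFreyModularityCDT
import Literature.NumberTheory.EllipticCurves.ModularJacobianMultiplicityOne
import HarnessLib

/-!
# Route IsogenyGlueCongruence, item `ModularJacobianMultipliers` (stmt-ABC-13920): the item from
# two named facts

`Summits/ABC/ABC/Theorems/IsogenyGlueCongruenceModularJacobianMultipliers.lean` proves every part of
the item `ModularJacobianMultipliers` that does not live on the modular Jacobian, and reduces the
item to modularity (`exists_isNewformOf`) plus one hypothesis on `J₀(N)`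
(`modularJacobianMultipliers_of_modularity_of_generators`). That hypothesis is the published
result recorded as the named fact
`Literature.NumberTheory.EllipticCurves.ModularForms.exists_modularJacobian_hom_generators`
(`Literature/NumberTheory/EllipticCurves/ModularJacobianMultiplicityOne.lean`): the Jacobian
`J₀(N)` of `X₀(N)` is an abelian variety over `ℚ` of dimension `g(X₀(N))` (Shimura 1971,
Thm. 7.14 with Prop. 1.40), and for an elliptic curve `E/ℚ` of conductor `N` (globally minimal
model) `Hom_ℚ(E, J₀(N)) = ℤ ι`, `Hom_ℚ(J₀(N), E) = ℤ π` with `π ∘ ι = [m]`, `m` the minimal degree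
of a modular parametrisation datum (the optimal quotient and multiplicity one: Agashe–Ribet–Stein
2012, §2.1 and §3). This file proves:

* `modularJacobianMultipliers_iff_of_jacobian`: GIVEN the Jacobian fact, the item is EQUIVALENT
  to the modularity of semistable elliptic curves over `ℚ`, `∀ W semistable, BCDT.IsModular W`
  ("a newform of `W` exists at level `N_W`"; Wiles 1995, Thm. 0.4) — so the item's content beyond
  `J₀(N)` is exactly Wiles' theorem. Per curve, a newform yields a datum unconditionally: the
  Néron-type lattice (`exists_isNeronLatticeOf_holds`), a non-zero integral multiplier `c Λ_f ⊆ Λ_E`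
  (`IsNewformOf.exists_maninConstant_ne_zero_holds`: Shimura's construction and Faltings, theorems
  of the tree) and the assembled datum `nonempty_modularParametrizationData_of_isNewformOf` (file
  `DefiniteXiFreyModularityCDT` of route DefiniteXi, reused here);
* `modularJacobianMultipliers_of_facts`: the item from the two named facts `exists_isNewformOf`
  (BCDT 2001, Thm. A) and `exists_modularJacobian_hom_generators`.

Trust base of the item after this file: `exists_isNewformOf` (only its semistable case is used)
and `exists_modularJacobian_hom_generators`.

## References

* G. Shimura, *Introduction to the arithmetic theory of automorphic functions* (1971): Prop. 1.40,
  Thm. 7.14. [ShimuraIATAF1971]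
* A. Agashe, K. Ribet, W. Stein, *The modular degree, congruence primes, and multiplicity one*,
  in: Number Theory, Analysis and Geometry (in memory of S. Lang), Springer (2012), §2.1, §3
  (Lemma 3.1, Def. 3.2). [AgasheRibetStein2012]
* G. Faltings, *Endlichkeitssätze für abelsche Varietäten über Zahlkörpern*, Invent. Math. 73
  (1983), Kor. 2 zu Satz 4. [Faltings1983]
* B. Edixhoven, *On the Manin constants of modular elliptic curves* (1991), Prop. 2.
  [EdixhovenManin1991]
* A. Wiles, *Modular elliptic curves and Fermat's Last Theorem*, Ann. of Math. 141 (1995),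
  Thm. 0.4. [Wiles1995Annals]
* C. Breuil, B. Conrad, F. Diamond, R. Taylor, J. Amer. Math. Soc. 14 (2001), Thm. A.
  [BCDTJAMS2001]
-/

-- `Summit.<Summit>.<Problem>` is the mandated summit-side namespace (CONVENTIONS §2); for the
-- single-conjunct summit `ABC` the two coincide, so the duplicate `ABC.ABC` is deliberate.
set_option linter.dupNamespace false

noncomputable section

open CategoryTheory
open Literature.NumberTheory.EllipticCurves.ModularForms
open Literature.NumberTheory.Automorphic
open Literature.AlgebraicGeometry.Motives

namespace Summit.ABC.ABC.Theorems

/-! ### The item is semistable modularity, given the Jacobian fact -/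

/-- **Given the modular-Jacobian fact, `ModularJacobianMultipliers` is EQUIVALENT to the
modularity of semistable elliptic curves over `ℚ`** — `BCDT.IsModular W` for every semistable
elliptic `W/ℚ` given by a globally minimal model, i.e. "a newform `f ∈ S₂(Γ₀(N_W))` of `W` exists"
(Wiles 1995, Thm. 0.4, with Taylor–Wiles; for all curves BCDT 2001, Thm. A = `exists_isNewformOf`,
see `BCDT.exists_isNewformOf_iff`): (→) a datum carries the newform of `W`
(`exists_isNewformOf_of_modularJacobianMultipliers`); (←) given the newform `f`, a Néron-type
period pair `L` of `W/ℂ` (`exists_isNeronLatticeOf_holds`) and an integer `c ≠ 0` with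
`c Λ_f ⊆ Λ_L` (`IsNewformOf.exists_maninConstant_ne_zero_holds`) give a datum
(`nonempty_modularParametrizationData_of_isNewformOf`, all unconditional), hence one of minimal
degree (`exists_forall_modularDegree_le`); the fact `exists_modularJacobian_hom_generators` supplies `E`,
`J = J₀(N)`, `e`, `ι`, `π` for it, `dim J = g(X₀(N)) ≤ N²` (`genusX0_cast_le_sq`), and since
`Hom(E, J) = ℤι`, `Hom(J, E) = ℤπ`, `ι ≫ π = deg φ_D • 𝟙 E` with `deg φ_D ≠ 0`, the `E`-multipliers
of `J` are the multiples of `deg φ_D` (`multipliers_of_generators`). So the exact content of the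
item beyond the Jacobian fact is Wiles' theorem. -/
theorem modularJacobianMultipliers_iff_of_jacobian (hJ : exists_modularJacobian_hom_generators) :
    Summit.ABC.ABC.Theses.IsogenyGlueCongruence.ModularJacobianMultipliers ↔
      ∀ (W : WeierstrassCurve ℚ) [W.IsElliptic] [W.IsGloballyMinimal]
        [NeZero (W.conductorNorm ℤ)], W.IsSemistable ℤ → BCDT.IsModular W := by
  refine ⟨fun h W _ _ _ hW ↦ exists_isNewformOf_of_modularJacobianMultipliers h W hW,
    fun hmod W _ _ _ hW ↦ ?_⟩
  obtain ⟨f, hf⟩ := hmod W hW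
  haveI : (W.baseChange ℂ).IsElliptic := by rw [WeierstrassCurve.baseChange]; infer_instance
  obtain ⟨L, hL⟩ := exists_isNeronLatticeOf_holds (W.baseChange ℂ)
  obtain ⟨c, hc0, hc⟩ := IsNewformOf.exists_maninConstant_ne_zero_holds hf hL
  obtain ⟨D, hD⟩ :=
    exists_forall_modularDegree_le (nonempty_modularParametrizationData_of_isNewformOf hf hL hc0 hc)
  obtain ⟨E, J, e, ι, π, he, hdim, hd, hι, hπ⟩ := hJ W D hD
  have hd0 : (D.modularDegree : ℤ) ≠ 0 := by exact_mod_cast D.deg_pos.ne'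
  obtain ⟨hex, hdvd⟩ := multipliers_of_generators E J e ι π _ hd0 hd hι hπ
  refine ⟨D, E, J, e, he, ?_, hex, hdvd⟩
  calc (J.dim : ℝ) = genusX0 (W.conductorNorm ℤ) := by exact_mod_cast hdim
    _ ≤ (W.conductorNorm ℤ : ℝ) ^ 2 := genusX0_cast_le_sq _

/-- **`ModularJacobianMultipliers` from the two named facts** — modularity (`exists_isNewformOf`,
BCDT 2001 Thm. A; only its semistable case, Wiles 1995, is used) and the modular Jacobian with
multiplicity one (`exists_modularJacobian_hom_generators`: Shimura 1971 Thm. 7.14,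
Agashe–Ribet–Stein 2012 §2.1 and §3), by `modularJacobianMultipliers_iff_of_jacobian`. This is the
closed form of the item modulo named facts: it closes as
`modularJacobianMultipliers_of_facts exists_isNewformOf_holds exists_modularJacobian_hom_generators_holds`
the day both facts are discharged. -/
theorem modularJacobianMultipliers_of_facts (hmod : exists_isNewformOf)
    (hJ : exists_modularJacobian_hom_generators) :
    Summit.ABC.ABC.Theses.IsogenyGlueCongruence.ModularJacobianMultipliers :=
  (modularJacobianMultipliers_iff_of_jacobian hJ).mpr fun W _ _ _ _ ↦
    BCDT.exists_isNewformOf_iff.mp hmod W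

end Summit.ABC.ABC.Theorems

end
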